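import Summits.Ventures.YMGap.RobustBall.RobustAreaLawVertex
import Summits.Ventures.YMGap.RobustBall.RowsSU2
import Summits.Ventures.YMGap.RobustBall.TorusRowsSU2
import HarnessLib

/-!
# Robust ball (Y2), area-law side — the CERTIFIED FRONTIER `ε(β_W)` of the affine-vertex door, `SU(2)`, `d = 4`

HONEST FRAMING: venture file of the cell `pub-ymgap` (QuantumFields programme), track ROBUST-BALL, seat rb-p2 (g2).  Strong-coupling LATTICE
statements on finite tori, uniform in the size; nothing about the continuum, a mass gap, or Clay.

WHAT.  rb-p2 g0 certified the area law on the one-parameter tier-1 ball `(ε₀, ε₁) = (2ε, ε)` at two couplings of the affine-vertex door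
(`su2_areaLawOnBall_oneThird_vertex`: `(β_W, ε) = (1/3, 0.15)`; `…_oneHalf_vertex`: `(1/2, 0.06)`).  This file tabulates the door's WHOLE FRONTIER:
a generic row checker `su2_areaLawOnBall_of_vertexBounds` (the two vertex conditions `e^{2ε}(3β_W/2)(1 + 2√2 ε) < 1`, `e^{2ε}(3β_W/2) + √2 ε < 1`
under numeric majorants `e^{2ε} ≤ E`, `√2 ≤ S`) and thirteen certified rows
`(β_W, ε) = (1/10, .447), (1/8, .407), (1/6, .349), (1/5, .296), (1/4, .235), (3/10, .186), (1/3, .159), (2/5, .114), (9/20, .086), (1/2, .062),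
(11/20, .041), (3/5, .022), (5/8, .013)` — `AreaLawOnBall 2 4 (β_W/2) (2ε) ε r mv` for every range `r` and window `mv ≥ 1` — each `ε` being the
largest multiple of `1/1000` the door admits under the majorants `E = T₄(2ε) = 1 + x + x²/2 + x³/6 + 5x⁴/96` (`exp_le_taylor4`) and `S = 1.41422`
(`sqrt_two_le`); the door's float optimum is printed per row (it exceeds the certified value by `< 0.0015`).  Exact rational arithmetic (`norm_num`).
SECOND LINEAGE: rb-theory's float screen `HOME/rb/certs/rb_rows.py` / rb-ref's lineage R re-derive the same cells.
WHAT THIS IS NOT.  The frontier is the DOOR's (Dobrushin uniqueness technology on the quarter modulus), not the extent of the confining phase: larger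
balls may well obey the area law; nothing is claimed at or beyond the door's Wilson threshold `β_W = 2/3`; the radii vanish there linearly
(`AreaLawRadius.su2_areaLawOnBall_radius`).
-/

noncomputable section

open MeasureTheory Real
open Literature.MathematicalPhysics.QuantumLattice (fundamentalRep)
open Literature.MathematicalPhysics.QuantumFieldTheory

namespace Summit.Ventures.YMGap.RobustBall

/-- **Row checker for the affine-vertex door, `SU(2)`, `d = 4`, one-parameter ball `(2ε, ε)`.**  If `0 ≤ β_W`, `3β_W/2 ≤ 1`, `0 ≤ ε`,
`e^{2ε} ≤ E`, `√2 ≤ S` and the two majorised vertex conditions `E(3β_W/2)(1 + 2Sε) < 1`, `E(3β_W/2) + Sε < 1` hold, then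
`AreaLawOnBall 2 4 (β_W/2) (2ε) ε r mv` for every `r` and `mv ≥ 1` (g0's `su2_areaLawOnBall_of_vertexRow`). [folklore] -/
theorem su2_areaLawOnBall_of_vertexBounds {βW ε E S : ℝ} (hβ : 0 ≤ βW) (hβ1 : 3 * βW / 2 ≤ 1) (hε : 0 ≤ ε)
    (hE : exp (2 * ε) ≤ E) (hS : Real.sqrt 2 ≤ S) (h1 : E * (3 * βW / 2) * (1 + 2 * S * ε) < 1)
    (h2 : E * (3 * βW / 2) + S * ε < 1) (r : ℕ) {mv : ℕ} (hmv : 1 ≤ mv) :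
    AreaLawOnBall 2 4 (βW / 2) (2 * ε) ε r mv := by
  have hx : 0 ≤ 3 * βW / 2 := by positivity
  have hE0 : 0 < exp (2 * ε) := exp_pos _
  have hS0 : 0 ≤ Real.sqrt 2 := Real.sqrt_nonneg _
  have hA : exp (2 * ε) * (3 * βW / 2) ≤ E * (3 * βW / 2) := mul_le_mul_of_nonneg_right hE hx
  have hB : 1 + 2 * Real.sqrt 2 * ε ≤ 1 + 2 * S * ε := by nlinarith
  have hB0 : 0 ≤ 1 + 2 * Real.sqrt 2 * ε := by positivity
  show AreaLawOnBall 2 (3 + 1) _ _ _ r mv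
  refine su2_areaLawOnBall_of_vertexRow hβ hβ1 r hmv ?_ ?_
  · calc exp (2 * ε) * (3 * βW / 2) * (1 + 2 * Real.sqrt 2 * ε)
        ≤ E * (3 * βW / 2) * (1 + 2 * S * ε) := mul_le_mul hA hB hB0 (by nlinarith)
      _ < 1 := h1
  · have : Real.sqrt 2 * ε ≤ S * ε := mul_le_mul_of_nonneg_right hS hε
    linarith

/-! ### The frontier rows (each `ε` maximal at `1/1000` under the majorants; float optimum of the door in brackets) -/

/-- `(β_W, ε) = (1/10, 0.447)` [door optimum `0.4475`]: `AreaLawOnBall 2 4 (1/20) (447/500) (447/1000) r mv`. [folklore] -/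
theorem su2_frontier_1_10 (r : ℕ) {mv : ℕ} (hmv : 1 ≤ mv) : AreaLawOnBall 2 4 (1 / 20) (447 / 500) (447 / 1000) r mv := by
  have h := su2_areaLawOnBall_of_vertexBounds (βW := 1 / 10) (ε := 447 / 1000) (by norm_num) (by norm_num) (by norm_num)
    (exp_le_taylor4 (by norm_num) (by norm_num)) sqrt_two_le (by norm_num) (by norm_num) r hmv
  norm_num at h
  exact h

/-- `(β_W, ε) = (1/8, 0.407)` [door optimum `0.4075`]: `AreaLawOnBall 2 4 (1/16) (407/500) (407/1000) r mv`. [folklore] -/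
theorem su2_frontier_1_8 (r : ℕ) {mv : ℕ} (hmv : 1 ≤ mv) : AreaLawOnBall 2 4 (1 / 16) (407 / 500) (407 / 1000) r mv := by
  have h := su2_areaLawOnBall_of_vertexBounds (βW := 1 / 8) (ε := 407 / 1000) (by norm_num) (by norm_num) (by norm_num)
    (exp_le_taylor4 (by norm_num) (by norm_num)) sqrt_two_le (by norm_num) (by norm_num) r hmv
  norm_num at h
  exact h

/-- `(β_W, ε) = (1/6, 0.349)` [door optimum `0.3495`]: `AreaLawOnBall 2 4 (1/12) (349/500) (349/1000) r mv`. [folklore] -/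
theorem su2_frontier_1_6 (r : ℕ) {mv : ℕ} (hmv : 1 ≤ mv) : AreaLawOnBall 2 4 (1 / 12) (349 / 500) (349 / 1000) r mv := by
  have h := su2_areaLawOnBall_of_vertexBounds (βW := 1 / 6) (ε := 349 / 1000) (by norm_num) (by norm_num) (by norm_num)
    (exp_le_taylor4 (by norm_num) (by norm_num)) sqrt_two_le (by norm_num) (by norm_num) r hmv
  norm_num at h
  exact h

/-- `(β_W, ε) = (1/5, 0.296)` [door optimum `0.2971`]: `AreaLawOnBall 2 4 (1/10) (74/125) (37/125) r mv`. [folklore] -/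
theorem su2_frontier_1_5 (r : ℕ) {mv : ℕ} (hmv : 1 ≤ mv) : AreaLawOnBall 2 4 (1 / 10) (74 / 125) (37 / 125) r mv := by
  have h := su2_areaLawOnBall_of_vertexBounds (βW := 1 / 5) (ε := 37 / 125) (by norm_num) (by norm_num) (by norm_num)
    (exp_le_taylor4 (by norm_num) (by norm_num)) sqrt_two_le (by norm_num) (by norm_num) r hmv
  norm_num at h
  exact h

/-- `(β_W, ε) = (1/4, 0.235)` [door optimum `0.2353`]: `AreaLawOnBall 2 4 (1/8) (47/100) (47/200) r mv`. [folklore] -/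
theorem su2_frontier_1_4 (r : ℕ) {mv : ℕ} (hmv : 1 ≤ mv) : AreaLawOnBall 2 4 (1 / 8) (47 / 100) (47 / 200) r mv := by
  have h := su2_areaLawOnBall_of_vertexBounds (βW := 1 / 4) (ε := 47 / 200) (by norm_num) (by norm_num) (by norm_num)
    (exp_le_taylor4 (by norm_num) (by norm_num)) sqrt_two_le (by norm_num) (by norm_num) r hmv
  norm_num at h
  exact h

/-- `(β_W, ε) = (3/10, 0.186)` [door optimum `0.1870`]: `AreaLawOnBall 2 4 (3/20) (93/250) (93/500) r mv`. [folklore] -/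
theorem su2_frontier_3_10 (r : ℕ) {mv : ℕ} (hmv : 1 ≤ mv) : AreaLawOnBall 2 4 (3 / 20) (93 / 250) (93 / 500) r mv := by
  have h := su2_areaLawOnBall_of_vertexBounds (βW := 3 / 10) (ε := 93 / 500) (by norm_num) (by norm_num) (by norm_num)
    (exp_le_taylor4 (by norm_num) (by norm_num)) sqrt_two_le (by norm_num) (by norm_num) r hmv
  norm_num at h
  exact h

/-- `(β_W, ε) = (1/3, 0.159)` [door optimum `0.1600`; g0's row: `0.15`]: `AreaLawOnBall 2 4 (1/6) (159/500) (159/1000) r mv`. [folklore] -/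
theorem su2_frontier_1_3 (r : ℕ) {mv : ℕ} (hmv : 1 ≤ mv) : AreaLawOnBall 2 4 (1 / 6) (159 / 500) (159 / 1000) r mv := by
  have h := su2_areaLawOnBall_of_vertexBounds (βW := 1 / 3) (ε := 159 / 1000) (by norm_num) (by norm_num) (by norm_num)
    (exp_le_taylor4 (by norm_num) (by norm_num)) sqrt_two_le (by norm_num) (by norm_num) r hmv
  norm_num at h
  exact h

/-- `(β_W, ε) = (2/5, 0.114)` [door optimum `0.1148`]: `AreaLawOnBall 2 4 (1/5) (57/250) (57/500) r mv`. [folklore] -/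
theorem su2_frontier_2_5 (r : ℕ) {mv : ℕ} (hmv : 1 ≤ mv) : AreaLawOnBall 2 4 (1 / 5) (57 / 250) (57 / 500) r mv := by
  have h := su2_areaLawOnBall_of_vertexBounds (βW := 2 / 5) (ε := 57 / 500) (by norm_num) (by norm_num) (by norm_num)
    (exp_le_taylor4 (by norm_num) (by norm_num)) sqrt_two_le (by norm_num) (by norm_num) r hmv
  norm_num at h
  exact h

/-- `(β_W, ε) = (9/20, 0.086)` [door optimum `0.0868`]: `AreaLawOnBall 2 4 (9/40) (43/250) (43/500) r mv`. [folklore] -/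
theorem su2_frontier_9_20 (r : ℕ) {mv : ℕ} (hmv : 1 ≤ mv) : AreaLawOnBall 2 4 (9 / 40) (43 / 250) (43 / 500) r mv := by
  have h := su2_areaLawOnBall_of_vertexBounds (βW := 9 / 20) (ε := 43 / 500) (by norm_num) (by norm_num) (by norm_num)
    (exp_le_taylor4 (by norm_num) (by norm_num)) sqrt_two_le (by norm_num) (by norm_num) r hmv
  norm_num at h
  exact h

/-- `(β_W, ε) = (1/2, 0.062)` [door optimum `0.0625`; g0's row: `0.06`]: `AreaLawOnBall 2 4 (1/4) (31/250) (31/500) r mv`. [folklore] -/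
theorem su2_frontier_1_2 (r : ℕ) {mv : ℕ} (hmv : 1 ≤ mv) : AreaLawOnBall 2 4 (1 / 4) (31 / 250) (31 / 500) r mv := by
  have h := su2_areaLawOnBall_of_vertexBounds (βW := 1 / 2) (ε := 31 / 500) (by norm_num) (by norm_num) (by norm_num)
    (exp_le_taylor4 (by norm_num) (by norm_num)) sqrt_two_le (by norm_num) (by norm_num) r hmv
  norm_num at h
  exact h

/-- `(β_W, ε) = (11/20, 0.041)` [door optimum `0.0411`]: `AreaLawOnBall 2 4 (11/40) (41/500) (41/1000) r mv`. [folklore] -/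
theorem su2_frontier_11_20 (r : ℕ) {mv : ℕ} (hmv : 1 ≤ mv) : AreaLawOnBall 2 4 (11 / 40) (41 / 500) (41 / 1000) r mv := by
  have h := su2_areaLawOnBall_of_vertexBounds (βW := 11 / 20) (ε := 41 / 1000) (by norm_num) (by norm_num) (by norm_num)
    (exp_le_taylor4 (by norm_num) (by norm_num)) sqrt_two_le (by norm_num) (by norm_num) r hmv
  norm_num at h
  exact h

/-- `(β_W, ε) = (3/5, 0.022)` [door optimum `0.0222`]: `AreaLawOnBall 2 4 (3/10) (11/250) (11/500) r mv`. [folklore] -/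
theorem su2_frontier_3_5 (r : ℕ) {mv : ℕ} (hmv : 1 ≤ mv) : AreaLawOnBall 2 4 (3 / 10) (11 / 250) (11 / 500) r mv := by
  have h := su2_areaLawOnBall_of_vertexBounds (βW := 3 / 5) (ε := 11 / 500) (by norm_num) (by norm_num) (by norm_num)
    (exp_le_taylor4 (by norm_num) (by norm_num)) sqrt_two_le (by norm_num) (by norm_num) r hmv
  norm_num at h
  exact h

/-- `(β_W, ε) = (5/8, 0.013)` [door optimum `0.0135`]: `AreaLawOnBall 2 4 (5/16) (13/500) (13/1000) r mv`. [folklore] -/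
theorem su2_frontier_5_8 (r : ℕ) {mv : ℕ} (hmv : 1 ≤ mv) : AreaLawOnBall 2 4 (5 / 16) (13 / 500) (13 / 1000) r mv := by
  have h := su2_areaLawOnBall_of_vertexBounds (βW := 5 / 8) (ε := 13 / 1000) (by norm_num) (by norm_num) (by norm_num)
    (exp_le_taylor4 (by norm_num) (by norm_num)) sqrt_two_le (by norm_num) (by norm_num) r hmv
  norm_num at h
  exact h

/-- The frontier table as one conjunction of kernel numerals (for citation): the thirteen certified cells `(β_W, ε)`. [folklore] -/
theorem su2_frontier_table (r : ℕ) {mv : ℕ} (hmv : 1 ≤ mv) :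
    AreaLawOnBall 2 4 (1 / 20) (447 / 500) (447 / 1000) r mv ∧ AreaLawOnBall 2 4 (1 / 16) (407 / 500) (407 / 1000) r mv ∧
    AreaLawOnBall 2 4 (1 / 12) (349 / 500) (349 / 1000) r mv ∧ AreaLawOnBall 2 4 (1 / 10) (74 / 125) (37 / 125) r mv ∧
    AreaLawOnBall 2 4 (1 / 8) (47 / 100) (47 / 200) r mv ∧ AreaLawOnBall 2 4 (3 / 20) (93 / 250) (93 / 500) r mv ∧
    AreaLawOnBall 2 4 (1 / 6) (159 / 500) (159 / 1000) r mv ∧ AreaLawOnBall 2 4 (1 / 5) (57 / 250) (57 / 500) r mv ∧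
    AreaLawOnBall 2 4 (9 / 40) (43 / 250) (43 / 500) r mv ∧ AreaLawOnBall 2 4 (1 / 4) (31 / 250) (31 / 500) r mv ∧
    AreaLawOnBall 2 4 (11 / 40) (41 / 500) (41 / 1000) r mv ∧ AreaLawOnBall 2 4 (3 / 10) (11 / 250) (11 / 500) r mv ∧
    AreaLawOnBall 2 4 (5 / 16) (13 / 500) (13 / 1000) r mv :=
  ⟨su2_frontier_1_10 r hmv, su2_frontier_1_8 r hmv, su2_frontier_1_6 r hmv, su2_frontier_1_5 r hmv, su2_frontier_1_4 r hmv,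
    su2_frontier_3_10 r hmv, su2_frontier_1_3 r hmv, su2_frontier_2_5 r hmv, su2_frontier_9_20 r hmv, su2_frontier_1_2 r hmv,
    su2_frontier_11_20 r hmv, su2_frontier_3_5 r hmv, su2_frontier_5_8 r hmv⟩

end Summit.Ventures.YMGap.RobustBall

end
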